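import Literature.MathematicalPhysics.QuantumLattice.FermiRG.BGM2006LevelRouting
import Literature.MathematicalPhysics.QuantumLattice.GrassmannVertexPositionsOriented
import HarnessLib

/-!
# The orientation oracle: discharging the reading hypothesis of the oriented suppliers by the level routing of BGM 2006, App. A4

Topic `Literature/MathematicalPhysics/QuantumLattice/FermiRG`; companion of `BGM2006LevelRouting` (`exists_orientation_lumps`: for every
rooted tree and known-leg profile there is a reading of the lines with fixed-slot counts in `[1, 5]` whose lumps add up to the lumps of the
whole) and of the oriented Grassmann suppliers (`GrassmannWeightedLaplacianTruncatedBoundOriented` … `SectorisedIncrementBoundGradedWeightedOrientedPlateau`),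
which ask an ORACLE: for every covering valid script `s` rooted at `b` and every landing profile `pf` of the prescribed legs, some reading `o`
with `∏_a N_a(|pf⁻¹ a| + swChildren s o a + [a = b ∨ o a]) ≤ Nφ`.  Here the dictionary between the script (`Script.pa`, `swChildren`) and the
rooted tree of the routing file (`IsRootedTree`, `fixedCount`) is set up, and the oracle is discharged for levelled sizes dominated by
`B_a · θ^{lumps L}` and antitone in the level: `Nφ = (∏_a B_a) · θ^{lumps (1 + |J|)}`.

* `exists_orientation_prod_le` — the oracle bound.

Everything is proved; no named fact.

## Sources

G. Benfatto, A. Giuliani, V. Mastropietro, Ann. Henri Poincaré 7 (2006) 809–898, §2.8 (2.97)–(2.98), App. A4 (A4.5)–(A4.8)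
(`BenfattoGiulianiMastropietro2006`).
-/

noncomputable section

namespace Literature.MathematicalPhysics.QuantumLattice.FermiRG

open Finset Literature.Probability.LatticeModels Literature.Probability.LatticeModels.BattleFederbush
open Literature.MathematicalPhysics.QuantumLattice BGM2006Routing

variable {n : ℕ} {b : Fin n} {k : ℕ}

/-- The parent map of a script, read on the indices `0, …, k` of its points (`0` the root, sent to itself): a rooted tree in the sense of
`BGM2006Routing.IsRootedTree`. [cite: BenfattoGiulianiMastropietro2006, §2.4 (trees of the expansion)] -/
theorem isRootedTree_script_pa (s : Script b k) :
    IsRootedTree (fun i : Fin (k + 1) => Fin.cases (motive := fun _ => Fin (k + 1)) 0 (fun m => s.pa m) i) := by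
  intro i hi
  cases i using Fin.cases with
  | zero => exact absurd rfl hi
  | succ m =>
    simp only [Fin.cases_succ, Fin.val_succ]
    exact Nat.lt_succ_of_le (Script.pa_le s m)

/-- **THE ORIENTATION ORACLE** (BGM 2006 App. A4 (A4.8) with §2.8 (2.98)): for a covering valid script `s` rooted at `b`, a landing profile
`pf` of the prescribed legs, and levelled sizes `N_a(L) ≥ 0` antitone in the level and dominated by `B_a · θ^{lumps L}` for `L ≥ 1`, some
reading `o` of the lines has `∏_a N_a(|pf⁻¹ a| + swChildren s o a + [a = b ∨ o a]) ≤ (∏_a B_a) · θ^{lumps (1 + |J|)}`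
(no sign hypotheses on `B`, `θ` are needed: the routing gives `Σ_a lumps = lumps (1 + |J|)` exactly).
[cite: BenfattoGiulianiMastropietro2006, App. A4 (A4.8); §2.8 (2.97)-(2.98)] -/
theorem exists_orientation_prod_le (s : Script b k) (hs : s.Valid) (hcov : univ.image s.y = univ)
    {ι : Type*} (J : Finset ι) (pf : J → Fin n)
    (Nl : Fin n → ℕ → ℝ) (hNl0 : ∀ a L, 0 ≤ Nl a L) (hanti : ∀ a L L', L ≤ L' → Nl a L' ≤ Nl a L)
    (Bm : Fin n → ℝ) {θ : ℝ} (hNl : ∀ a L, 1 ≤ L → Nl a L ≤ Bm a * θ ^ lumps L) :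
    ∃ o : Fin n → Bool, ∏ a, Nl a ((univ.filter fun j : J => pf j = a).card + swChildren s o a + if a = b ∨ o a = true then 1 else 0) ≤
      (∏ a, Bm a) * θ ^ lumps (1 + J.card) := by
  classical
  -- the points of the script: a bijection `Fin (k+1) ≃ Fin n`
  have hyinj := Script.y_injective s hs
  have hysurj : Function.Surjective s.y := fun a => by
    have ha : a ∈ univ.image s.y := hcov ▸ mem_univ a
    obtain ⟨i, -, hi⟩ := mem_image.1 ha
    exact ⟨i, hi⟩
  set e : Fin (k + 1) ≃ Fin n := Equiv.ofBijective s.y ⟨hyinj, hysurj⟩ with he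
  have hey : ∀ i, e i = s.y i := fun i => rfl
  have hb : s.y 0 = b := Script.y_zero s
  -- the rooted tree and the known-leg profile on the indices
  set par : Fin (k + 1) → Fin (k + 1) := fun i => Fin.cases (motive := fun _ => Fin (k + 1)) 0 (fun m => s.pa m) i with hpar
  have hT : IsRootedTree par := isRootedTree_script_pa s
  set c : Fin (k + 1) → ℕ := fun i => (univ.filter fun j : J => pf j = s.y i).card with hc
  have hcsum : 1 + ∑ i, c i = 1 + J.card := by
    congr 1
    rw [hc]
    calc ∑ i, (univ.filter fun j : J => pf j = s.y i).card
        = ∑ a, (univ.filter fun j : J => pf j = a).card :=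
          Fintype.sum_equiv e (fun i => (univ.filter fun j : J => pf j = s.y i).card) (fun a => (univ.filter fun j : J => pf j = a).card)
            fun i => rfl
      _ = (univ : Finset J).card := (card_eq_sum_card_fiberwise (f := pf) (t := univ) fun j _ => mem_univ _).symm
      _ = J.card := by rw [card_univ, Fintype.card_coe]
  obtain ⟨c', o', hc'le, h1, h5, hsum⟩ := exists_orientation_lumps hT c hcsum
  -- the reading on the vertices
  refine ⟨fun a => o' (e.symm a), ?_⟩
  have ho : ∀ i, o' (e.symm (s.y i)) = o' i := fun i => by rw [← hey, Equiv.symm_apply_apply]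
  -- the dictionary: levels of the oriented suppliers = fixed-slot counts of the routing
  have hdict : ∀ i : Fin (k + 1),
      (univ.filter fun j : J => pf j = s.y i).card + swChildren s (fun a => o' (e.symm a)) (s.y i) +
        (if s.y i = b ∨ o' (e.symm (s.y i)) = true then 1 else 0) = fixedCount par c o' i := by
    intro i
    rw [ho i]
    have hsw : swChildren s (fun a => o' (e.symm a)) (s.y i) = ((children par i).filter fun j => o' j = false).card := by
      unfold swChildren
      simp only [ho]
      have hiff : ∀ m : Fin k, (o' m.succ = false ∧ s.y (s.pa m) = s.y i) ↔ (o' m.succ = false ∧ s.pa m = i) := fun m =>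
        ⟨fun h => ⟨h.1, hyinj h.2⟩, fun h => ⟨h.1, by rw [h.2]⟩⟩
      simp only [hiff]
      rw [Finset.sum_boole, Nat.cast_id]
      rw [← card_map ⟨Fin.succ, Fin.succ_injective k⟩]
      refine congrArg card (Finset.ext fun j => ?_)
      simp only [mem_map, mem_filter, mem_univ, true_and, Function.Embedding.coeFn_mk, children]
      constructor
      · rintro ⟨m, ⟨hm1, hm2⟩, rfl⟩
        refine ⟨⟨by simp [Fin.val_succ], ?_⟩, hm1⟩
        simp only [hpar, Fin.cases_succ]
        exact hm2
      · rintro ⟨⟨hj0, hjpar⟩, hjo⟩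
        have hj0' : j ≠ 0 := fun h => hj0 (by simp [h])
        obtain ⟨m, rfl⟩ := Fin.eq_succ_of_ne_zero hj0'
        refine ⟨m, ⟨hjo, ?_⟩, rfl⟩
        simpa only [hpar, Fin.cases_succ] using hjpar
    rw [hsw, fixedCount]
    have hroot : (if s.y i = b ∨ o' i = true then 1 else 0) =
        (if (i : ℕ) = 0 then 1 else 0) + (if (i : ℕ) ≠ 0 ∧ o' i = true then 1 else 0) := by
      by_cases h0 : (i : ℕ) = 0
      · have hi0 : i = 0 := Fin.ext h0
        have hyb : s.y i = b := by rw [hi0, hb]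
        simp [hyb, h0]
      · have hyb : s.y i ≠ b := fun h => h0 (by
          have h' := hyinj (h.trans hb.symm)
          rw [h']; rfl)
        simp [hyb, h0]
    rw [hroot]
    ring
  -- the product over the vertices, read on the indices
  have hprod : ∀ f : Fin n → ℝ, ∏ a, f a = ∏ i : Fin (k + 1), f (s.y i) := fun f =>
    (Fintype.prod_equiv e (fun i => f (s.y i)) f fun i => rfl).symm
  rw [hprod, hprod Bm]
  have hfc_mono : ∀ i, fixedCount par c' o' i ≤ fixedCount par c o' i := fun i => by
    unfold fixedCount
    have := hc'le i
    omega
  calc ∏ i : Fin (k + 1), Nl (s.y i) ((univ.filter fun j : J => pf j = s.y i).card + swChildren s (fun a => o' (e.symm a)) (s.y i) +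
          if s.y i = b ∨ o' (e.symm (s.y i)) = true then 1 else 0)
      = ∏ i : Fin (k + 1), Nl (s.y i) (fixedCount par c o' i) := prod_congr rfl fun i _ => by rw [hdict i]
    _ ≤ ∏ i : Fin (k + 1), Bm (s.y i) * θ ^ lumps (fixedCount par c' o' i) := by
        refine prod_le_prod (fun i _ => hNl0 _ _) fun i _ => ?_
        exact (hanti _ _ _ (hfc_mono i)).trans (hNl _ _ (h1 i))
    _ = (∏ i : Fin (k + 1), Bm (s.y i)) * θ ^ lumps (1 + J.card) := by
        rw [prod_mul_distrib, prod_pow_eq_pow_sum, hsum]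

end Literature.MathematicalPhysics.QuantumLattice.FermiRG
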